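import Mathlib.NumberTheory.Harmonic.Bounds
import Mathlib.Algebra.Order.BigOperators.Group.Finset
import Mathlib.Data.Fintype.BigOperators

/-!
# A logarithmic shell sum on `ℤ⁴`: `Σ_{‖w‖_∞ ≤ R} (1 + ‖w‖₁)⁻⁴ ≤ 1 + 80·log(R+1)`

Elementary lattice-sum estimate used by the response bound K2 (`DirResponseL1`) of LINE-18 on crux `BulkMidWindowSU2` (stmt-QuantumFields-24006):
with the dipole law K1 `|K_H(p,q)| ≤ c(1+log H)/(1+dist(p,q))⁴` the kernel's ℓ¹ mass over the plaquettes of the box is `≲ (1+log H)·Σ_w (1+‖w‖₁)⁻⁴`, and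
the cube `{‖w‖_∞ ≤ R} ⊂ ℤ⁴` is exhausted by the shells `‖w‖_∞ = r` of cardinality `(2r+1)⁴ − (2r−1)⁴ ≤ 80r³`, on which `‖w‖₁ ≥ r`:
* `card_cube` — `#{w : Fin 4 → ℤ | ∀ m, |w m| ≤ r} = (2r+1)⁴`;
* `sum_cube_inv_pow_four_le_harmonic` — `Σ_{cube R} (1+‖w‖₁)⁻⁴ ≤ 1 + 80·Σ_{r=1}^{R} 1/(r+1)` (induction on `R`, one shell at a time);
* `sum_cube_inv_pow_four_le_log` — `≤ 1 + 80·log(R+1)` (Mathlib's `harmonic_le_one_add_log`).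
Pure Mathlib; no definition.  HONEST LABEL: an arithmetic helper; no stub, crux, rung or summit is proved; the Yang–Mills mass gap is NOT proved by this.
-/

set_option autoImplicit false

noncomputable section

open Finset

namespace Summit.QuantumFields.YangMills.Theorems.AllWindowsColdBox.ShellSum

/-- Membership in the cube of radius `r`. -/
theorem mem_cube {r : ℕ} {w : Fin 4 → ℤ} :
    w ∈ Fintype.piFinset (fun _ : Fin 4 => Finset.Icc (-(r : ℤ)) r) ↔ ∀ m, |w m| ≤ r := by
  simp [Fintype.mem_piFinset, abs_le]

/-- The cube of radius `r` in `ℤ⁴` has `(2r+1)⁴` points. -/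
theorem card_cube (r : ℕ) : #(Fintype.piFinset (fun _ : Fin 4 => Finset.Icc (-(r : ℤ)) r)) = (2 * r + 1) ^ 4 := by
  rw [Fintype.card_piFinset, Finset.prod_const, Finset.card_univ, Fintype.card_fin, Int.card_Icc]
  congr 1
  omega

/-- The cubes are nested. -/
theorem cube_subset_succ (r : ℕ) :
    Fintype.piFinset (fun _ : Fin 4 => Finset.Icc (-(r : ℤ)) r) ⊆
      Fintype.piFinset (fun _ : Fin 4 => Finset.Icc (-((r + 1 : ℕ) : ℤ)) (r + 1 : ℕ)) := by
  intro w hw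
  rw [mem_cube] at hw ⊢
  intro m; have := hw m; push_cast; linarith

/-- On the shell `cube (r+1) \ cube r` the ℓ¹ norm is at least `r+1`. -/
theorem succ_le_l1_of_mem_sdiff {r : ℕ} {w : Fin 4 → ℤ}
    (hw : w ∈ Fintype.piFinset (fun _ : Fin 4 => Finset.Icc (-((r + 1 : ℕ) : ℤ)) (r + 1 : ℕ)) \
      Fintype.piFinset (fun _ : Fin 4 => Finset.Icc (-(r : ℤ)) r)) :
    ((r : ℝ) + 1) ≤ ∑ m : Fin 4, (|w m| : ℝ) := by
  rw [Finset.mem_sdiff, mem_cube, mem_cube] at hw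
  obtain ⟨-, h2⟩ := hw
  push Not at h2
  obtain ⟨m, hm⟩ := h2
  have hm' : (r : ℝ) + 1 ≤ (|w m| : ℝ) := by
    have : (r : ℤ) + 1 ≤ |w m| := by omega
    exact_mod_cast this
  refine hm'.trans ?_
  have : (|w m| : ℝ) = ∑ k ∈ ({m} : Finset (Fin 4)), (|w k| : ℝ) := by simp
  rw [this]
  exact Finset.sum_le_sum_of_subset_of_nonneg (Finset.subset_univ _) fun _ _ _ => by positivity

/-- **Shell-by-shell bound**: `Σ_{cube R} (1 + ‖w‖₁)⁻⁴ ≤ 1 + 80·Σ_{r=1}^{R} 1/(r+1)`. -/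
theorem sum_cube_inv_pow_four_le_harmonic (R : ℕ) :
    ∑ w ∈ Fintype.piFinset (fun _ : Fin 4 => Finset.Icc (-(R : ℤ)) R), 1 / (1 + ∑ m : Fin 4, (|w m| : ℝ)) ^ 4 ≤
      1 + 80 * ∑ r ∈ Finset.Icc 1 R, 1 / ((r : ℝ) + 1) := by
  induction R with
  | zero =>
    have hcube : Fintype.piFinset (fun _ : Fin 4 => Finset.Icc (-((0 : ℕ) : ℤ)) (0 : ℕ)) = {0} := by
      ext w
      rw [mem_cube, Finset.mem_singleton]
      constructor
      · intro h; funext m; have := h m; simp at this; exact this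
      · rintro rfl m; simp
    rw [hcube]; simp
  | succ R ih =>
    have hsub := cube_subset_succ R
    rw [← Finset.sum_sdiff hsub]
    -- the new shell
    have hshell : ∑ w ∈ Fintype.piFinset (fun _ : Fin 4 => Finset.Icc (-((R + 1 : ℕ) : ℤ)) (R + 1 : ℕ)) \
        Fintype.piFinset (fun _ : Fin 4 => Finset.Icc (-(R : ℤ)) R), 1 / (1 + ∑ m : Fin 4, (|w m| : ℝ)) ^ 4 ≤
        80 * (1 / (((R + 1 : ℕ) : ℝ) + 1)) := by
      have hterm : ∀ w ∈ Fintype.piFinset (fun _ : Fin 4 => Finset.Icc (-((R + 1 : ℕ) : ℤ)) (R + 1 : ℕ)) \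
          Fintype.piFinset (fun _ : Fin 4 => Finset.Icc (-(R : ℤ)) R),
          1 / (1 + ∑ m : Fin 4, (|w m| : ℝ)) ^ 4 ≤ 1 / ((R : ℝ) + 2) ^ 4 := by
        intro w hw
        have h1 := succ_le_l1_of_mem_sdiff hw
        have hpos : (0 : ℝ) < ((R : ℝ) + 2) ^ 4 := by positivity
        exact one_div_le_one_div_of_le hpos (pow_le_pow_left₀ (by positivity) (by linarith) 4)
      refine (Finset.sum_le_sum hterm).trans ?_
      rw [Finset.sum_const, nsmul_eq_mul, Finset.card_sdiff_of_subset hsub, card_cube, card_cube]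
      have hc : (((2 * (R + 1) + 1) ^ 4 - (2 * R + 1) ^ 4 : ℕ) : ℝ) = (2 * (R : ℝ) + 3) ^ 4 - (2 * R + 1) ^ 4 := by
        have hle : (2 * R + 1) ^ 4 ≤ (2 * (R + 1) + 1) ^ 4 := Nat.pow_le_pow_left (by omega) 4
        rw [Nat.cast_sub hle]; push_cast; ring
      rw [hc]
      have hR : (0 : ℝ) ≤ R := Nat.cast_nonneg R
      rw [show (((R + 1 : ℕ) : ℝ) + 1) = (R : ℝ) + 2 by push_cast; ring]
      have hpoly : (2 * (R : ℝ) + 3) ^ 4 - (2 * R + 1) ^ 4 ≤ 80 * ((R : ℝ) + 2) ^ 3 := by nlinarith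
      have hpos : (0 : ℝ) < (R : ℝ) + 2 := by positivity
      calc ((2 * (R : ℝ) + 3) ^ 4 - (2 * R + 1) ^ 4) * (1 / ((R : ℝ) + 2) ^ 4)
          ≤ 80 * ((R : ℝ) + 2) ^ 3 * (1 / ((R : ℝ) + 2) ^ 4) :=
            mul_le_mul_of_nonneg_right hpoly (by positivity)
        _ = 80 * (1 / ((R : ℝ) + 2)) := by field_simp
    calc _ ≤ 80 * (1 / (((R + 1 : ℕ) : ℝ) + 1)) + (1 + 80 * ∑ r ∈ Finset.Icc 1 R, 1 / ((r : ℝ) + 1)) := add_le_add hshell ih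
      _ = 1 + 80 * ∑ r ∈ Finset.Icc 1 (R + 1), 1 / ((r : ℝ) + 1) := by
          rw [Finset.sum_Icc_succ_top (by omega : 1 ≤ R + 1)]; ring

/-- The harmonic tail: `Σ_{r=1}^{R} 1/(r+1) ≤ log(R+1)` (from Mathlib's `harmonic_le_one_add_log`). -/
theorem sum_Icc_one_div_succ_le_log (R : ℕ) :
    ∑ r ∈ Finset.Icc 1 R, 1 / ((r : ℝ) + 1) ≤ Real.log ((R : ℝ) + 1) := by
  have h := harmonic_le_one_add_log (R + 1)
  rw [harmonic_eq_sum_Icc] at h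
  push_cast at h
  -- `Σ_{i=1}^{R+1} 1/i = 1 + Σ_{r=1}^{R} 1/(r+1)`
  have hsplit : ∑ i ∈ Finset.Icc 1 (R + 1), ((i : ℝ))⁻¹ = 1 + ∑ r ∈ Finset.Icc 1 R, 1 / ((r : ℝ) + 1) := by
    have hI1 : Finset.Icc 1 (R + 1) = Finset.Ico 1 (R + 2) := (Finset.Ico_succ_right_eq_Icc 1 (R + 1)).symm
    have hI2 : Finset.Icc 1 R = Finset.Ico 1 (R + 1) := (Finset.Ico_succ_right_eq_Icc 1 R).symm
    rw [hI1, hI2, Finset.sum_eq_sum_Ico_succ_bot (by omega : 1 < R + 2), Finset.sum_Ico_eq_sum_range,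
      Finset.sum_Ico_eq_sum_range]
    simp only [Nat.cast_one, inv_one, show R + 2 - (1 + 1) = R by omega, show R + 1 - 1 = R by omega]
    congr 1
    refine Finset.sum_congr rfl fun k _ => ?_
    push_cast; ring
  rw [hsplit] at h
  linarith

/-- **The logarithmic shell sum**: `Σ_{‖w‖_∞ ≤ R} (1 + ‖w‖₁)⁻⁴ ≤ 1 + 80·log(R+1)` on `ℤ⁴`. -/
theorem sum_cube_inv_pow_four_le_log (R : ℕ) :
    ∑ w ∈ Fintype.piFinset (fun _ : Fin 4 => Finset.Icc (-(R : ℤ)) R), 1 / (1 + ∑ m : Fin 4, (|w m| : ℝ)) ^ 4 ≤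
      1 + 80 * Real.log ((R : ℝ) + 1) := by
  have h := sum_cube_inv_pow_four_le_harmonic R
  have h2 := sum_Icc_one_div_succ_le_log R
  linarith

end Summit.QuantumFields.YangMills.Theorems.AllWindowsColdBox.ShellSum

end
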